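import Literature.NumberTheory.GaloisRepresentations.WeilLAdicCharacterLocalShape
import Literature.NumberTheory.Automorphic.IdeleNormOneSplitting
import Literature.NumberTheory.Automorphic.IdeleClassBaseChangeInfinite
import HarnessLib

/-!
# The `ℓ`-adic avatar of an algebraic Hecke character of a totally complex field is unit-valued;
# the values of such a character at places away from `ℓ` are `ℓ`-adic units
# (Serre 1968, Ch. II §2.7 and Ch. III §1.1; Weil 1956 §1)

Topic `NumberTheory/GaloisRepresentations`; namespace
`Literature.NumberTheory.GaloisRepresentations.HeckeCharacter`. PROOFS ONLY (no definition, no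
named fact, no `sorry`). Requested by route `BiquadraticEisensteinDescent` of
`Summits/BirchSwinnertonDyer` (crux `EisensteinHeartFlatCMInertBadKPrime`): the INTEGRALITY clause
of the binder (L) `Hsieh2012.HasLocalMuZero ι Ψ w` ("every value `ι⁻¹(Ψ_w(x))` is `p`-integral")
of the anticyclotomic non-vanishing facts `Hsieh2012.thmA/rem69` / `HeWei2025.thm14`, for an
algebraic Hecke character of a CM (hence totally complex) field at a place `w ∤ p`.

For a number field `K`, a Hecke character `χ` of infinity type `(p, q)` (`HasInfinityType`), a
prime `ℓ` and `ι : ℚ̄_ℓ ≃ ℂ`, the tree's `ℓ`-adic avatar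
`ψ_ℓ = lAdicAvatarHom χ ι p q : 𝕀_K →* ℚ̄_ℓˣ` (`WeilLAdicCharacterLocalShape`; Serre's `χ_ℓ`) is
continuous, kills `Kˣ`, and equals `ι⁻¹ ∘ χ` on local ideles at places `w ∤ ℓ`. We prove, for `K`
TOTALLY COMPLEX:

* §1 `algPart_infiniteIdeles`, `HasInfinityType.lAdicAvatarHom_infiniteIdeles` — `ψ_ℓ` kills the
  infinite ideles `(y, 1)` (no real place, so `χ((y,1)) = A_{p,q}(y)` for every `y`,
  `HasInfinityType.apply_infiniteIdeles_eq`); in particular it kills Weil's split component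
  `M = ρ(ℝ_{>0})` (`lAdicAvatarHom_posRealIdele`).
* §2 **`HasInfinityType.norm_lAdicAvatarHom_eq_one`** — `‖ψ_ℓ(x)‖ = 1` for every idele `x`:
  `x ↦ ‖ψ_ℓ(x)‖` is a continuous homomorphism `𝕀_K → ℝ_{>0}` trivial on `Kˣ` and on `M`, hence
  bounded on `𝕀_K¹ = W·Kˣ` (`W` compact: Cassels–Fröhlich II §16, the tree's
  `exists_mem_normOneIdeleCover_mul_principalIdele`), hence trivial there (a bounded subgroup of
  `ℝ_{>0}` is trivial), and `𝕀_K = 𝕀_K¹·M` (`normOneRetraction`).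
* §3 **`HasInfinityType.norm_ιsymm_apply_localUnits_eq_one`** — at a place `w ∤ ℓ`,
  `‖ι⁻¹(χ(⟨z⟩_w))‖ = 1` for EVERY `z ∈ K_wˣ` (`ψ_ℓ(⟨z⟩_w) = ι⁻¹(χ(⟨z⟩_w))`,
  `coe_lAdicAvatarHom_localUnits_of_not_mem`): the local values of an algebraic Hecke character of
  a totally complex field away from `ℓ` are `ℓ`-adic units (Serre: `χ_ℓ` takes values in the units;
  for a Grössencharacter of type `(1,0)`: `ψ(𝔭)ψ̄(𝔭) = N𝔭`); `localComponent` form and the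
  `≤ 1` form consumed by `Hsieh2012.HasLocalMuZero`.

References: [SerreAbelianLadic1968] J.-P. Serre, *Abelian ℓ-adic representations and elliptic
curves* (1968), Ch. II §2.7 (the character `χ_ℓ` attached to an algebraic Hecke character is
continuous on the compact group `C_K/D_K`), Ch. III §1.1; [Weil1956] §1; [CasselsFrohlichANT1967]
Ch. II §16 (`J¹/kˣ` compact), [WeilBNT1967] Ch. IV §4 (the split component `M`).
-/

noncomputable section

open scoped NumberField NNReal
open NumberField IsDedekindDomain Filter
open Literature.NumberTheory.Automorphic

namespace Literature.NumberTheory.GaloisRepresentations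

namespace HeckeCharacter

open PadicEmbedding

variable {K : Type} [Field K] [NumberField K] {ℓ : ℕ} [Fact ℓ.Prime]
variable (ι : PadicAlgCl ℓ ≃+* ℂ) (p q : InfinitePlace K → ℤ)

/-! ### §1. The avatar kills the infinite ideles (totally complex `K`) -/

/-- The algebraic part `Λ(x) = ∏_{(v,e)} e(x_v)^{-n}` sees only the `ℓ`-adic components: it kills
the infinite ideles `(y, 1)`. [cite: SerreAbelianLadic1968, Ch. II §2.7] -/
theorem algPart_infiniteIdeles (y : (InfiniteAdeleRing K)ˣ) :
    algPart ι p q (infiniteIdeles K y) = 1 := by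
  rw [algPart_apply]
  refine Finset.prod_eq_one fun e _ ↦ ?_
  have he : e.eval (infiniteIdeles K y) = 1 := by
    refine Units.ext ?_
    rw [PlaceEmb.coe_eval, infiniteIdeles_snd, map_one, Units.val_one]
  rw [he, one_zpow]

variable {p q} {χ : HeckeCharacter K}

/-- **For `K` totally complex, `ψ_ℓ((y, 1)) = 1`** for every infinite idele: with no real place
every `y` is "totally positive", so `χ((y,1)) = A_{p,q}(y)` (`HasInfinityType.apply_infiniteIdeles_eq`)
and the unitary ratio is `1`; the algebraic part is `1` by `algPart_infiniteIdeles`.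
[cite: SerreAbelianLadic1968, Ch. II §2.7] [cite: Weil1956, §1] -/
theorem HasInfinityType.lAdicAvatarHom_infiniteIdeles [IsTotallyComplex K] (h : χ.HasInfinityType p q)
    (y : (InfiniteAdeleRing K)ˣ) : lAdicAvatarHom χ ι p q (infiniteIdeles K y) = 1 := by
  have hpos : InfiniteIdele.IsTotallyPositive y := fun w hw ↦
    ((InfinitePlace.not_isReal_iff_isComplex.mpr (IsTotallyComplex.isComplex w)) hw).elim
  have hχ := h.apply_infiniteIdeles_eq hpos
  have hA : archFactor p q y ≠ 0 := by
    rw [← hχ]; exact Units.ne_zero _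
  refine Units.ext ?_
  rw [coe_lAdicAvatarHom_apply, infPart_infiniteIdeles, hχ, mul_inv_cancel₀ hA, map_one,
    algPart_infiniteIdeles, Units.val_one, mul_one]

/-- `ψ_ℓ` kills Weil's split component `M = ρ(ℝ_{>0})` (diagonal positive reals at the archimedean
places). [cite: WeilBNT1967, Ch. IV §4 (the split component `M`)] -/
theorem HasInfinityType.lAdicAvatarHom_posRealIdele [IsTotallyComplex K] (h : χ.HasInfinityType p q)
    (t : ℝ≥0ˣ) : lAdicAvatarHom χ ι p q (posRealIdele K t) = 1 := by
  obtain ⟨y, hy⟩ := eq_infiniteIdeles_of_snd_eq_one (K := K) (x := posRealIdele K t)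
    (posRealIdele_snd K t)
  rw [hy]
  exact h.lAdicAvatarHom_infiniteIdeles ι y

/-! ### §2. The avatar is unit-valued -/

/-- `x ↦ ‖ψ_ℓ(x)‖` is multiplicative (bookkeeping for Serre's `χ_ℓ`).
[cite: SerreAbelianLadic1968, Ch. II §2.7] -/
theorem norm_lAdicAvatarHom_mul (x y : ideleGroup K) :
    ‖(lAdicAvatarHom χ ι p q (x * y) : PadicAlgCl ℓ)‖ =
      ‖(lAdicAvatarHom χ ι p q x : PadicAlgCl ℓ)‖ * ‖(lAdicAvatarHom χ ι p q y : PadicAlgCl ℓ)‖ := by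
  rw [map_mul, Units.val_mul, norm_mul]

/-- On the norm-one ideles `𝕀_K¹ = W·Kˣ` the function `‖ψ_ℓ(·)‖` is BOUNDED: it is `Kˣ`-invariant
and continuous on the compact `W`. [cite: CasselsFrohlichANT1967, Ch. II §16 Theorem (`J¹ = W·kˣ`, `W` compact)] -/
theorem HasInfinityType.exists_norm_lAdicAvatarHom_le (h : χ.HasInfinityType p q) :
    ∃ C : ℝ, ∀ x : ideleGroup K, IdeleClassGroup.ideleNorm K x = 1 →
      ‖(lAdicAvatarHom χ ι p q x : PadicAlgCl ℓ)‖ ≤ C := by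
  have hcont : Continuous fun x : ideleGroup K ↦ ‖(lAdicAvatarHom χ ι p q x : PadicAlgCl ℓ)‖ :=
    continuous_norm.comp (Units.continuous_val.comp (h.continuous_lAdicAvatarHom ι))
  obtain ⟨C, hC⟩ := (isCompact_normOneIdeleCover K).bddAbove_image hcont.continuousOn
  refine ⟨C, fun x hx ↦ ?_⟩
  obtain ⟨k, w, hw, rfl⟩ := exists_mem_normOneIdeleCover_mul_principalIdele K hx
  have hk : lAdicAvatarHom χ ι p q (Automorphic.principalIdele K k) = 1 :=
    lAdicAvatarHom_eq_one_of_mem ι (principalIdele_mem k)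
  rw [norm_lAdicAvatarHom_mul, hk, Units.val_one, norm_one, mul_one]
  exact hC ⟨w, hw, rfl⟩

/-- **`‖ψ_ℓ(x)‖ = 1` on `𝕀_K¹`**: a bounded multiplicative function on a group with values in
`ℝ_{>0}` is `1` (`c^n` bounded for all `n ∈ ℤ` forces `c = 1`). [cite: SerreAbelianLadic1968, Ch. II §2.7 (`χ_ℓ` continuous on the compact `C_K/D_K`)] -/
theorem HasInfinityType.norm_lAdicAvatarHom_eq_one_of_ideleNorm_eq_one (h : χ.HasInfinityType p q)
    {x : ideleGroup K} (hx : IdeleClassGroup.ideleNorm K x = 1) :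
    ‖(lAdicAvatarHom χ ι p q x : PadicAlgCl ℓ)‖ = 1 := by
  obtain ⟨C, hC⟩ := h.exists_norm_lAdicAvatarHom_le ι
  -- powers of `x` and of `x⁻¹` stay in `𝕀_K¹`
  have hpow : ∀ (y : ideleGroup K), IdeleClassGroup.ideleNorm K y = 1 → ∀ n : ℕ,
      ‖(lAdicAvatarHom χ ι p q y : PadicAlgCl ℓ)‖ ^ n ≤ C := fun y hy n ↦ by
    rw [← norm_pow, ← Units.val_pow_eq_pow_val, ← map_pow]
    exact hC _ (by rw [map_pow, hy, one_pow])
  have hle : ∀ (y : ideleGroup K), IdeleClassGroup.ideleNorm K y = 1 →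
      ‖(lAdicAvatarHom χ ι p q y : PadicAlgCl ℓ)‖ ≤ 1 := fun y hy ↦ by
    by_contra hlt
    push Not at hlt
    obtain ⟨n, hn⟩ := (tendsto_pow_atTop_atTop_of_one_lt hlt).eventually_gt_atTop C |>.exists
    exact (not_lt.mpr (hpow y hy n)) hn
  have h1 := hle x hx
  have h2 := hle x⁻¹ (by rw [map_inv, hx, inv_one])
  rw [map_inv, Units.val_inv_eq_inv_val, norm_inv] at h2
  have hpos : 0 < ‖(lAdicAvatarHom χ ι p q x : PadicAlgCl ℓ)‖ := norm_pos_iff.mpr (Units.ne_zero _)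
  have h3 : 1 ≤ ‖(lAdicAvatarHom χ ι p q x : PadicAlgCl ℓ)‖ := by
    rwa [inv_le_one₀ hpos] at h2
  exact le_antisymm h1 h3

/-- **The `ℓ`-adic avatar of an algebraic Hecke character of a totally complex field is
unit-valued: `‖ψ_ℓ(x)‖ = 1` for every idele `x`** (`𝕀_K = 𝕀_K¹ · M` by the retraction
`normOneRetraction`, and `ψ_ℓ` kills `M`). [cite: SerreAbelianLadic1968, Ch. II §2.7] [cite: WeilBNT1967, Ch. IV §4 Cor. 2 of Thm. 5] -/
theorem HasInfinityType.norm_lAdicAvatarHom_eq_one [IsTotallyComplex K] (h : χ.HasInfinityType p q)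
    (x : ideleGroup K) : ‖(lAdicAvatarHom χ ι p q x : PadicAlgCl ℓ)‖ = 1 := by
  obtain ⟨t, ht⟩ := normOneRetraction_inv_mul_mem K x
  have hx : x = normOneRetraction K x * posRealIdele K t := by
    rw [ht, mul_inv_cancel_left]
  rw [hx, norm_lAdicAvatarHom_mul, h.lAdicAvatarHom_posRealIdele ι t, Units.val_one, norm_one,
    mul_one]
  exact h.norm_lAdicAvatarHom_eq_one_of_ideleNorm_eq_one ι (ideleNorm_normOneRetraction K x)

/-! ### §3. Values away from `ℓ` are `ℓ`-adic units -/

/-- **`‖ι⁻¹(χ(⟨z⟩_w))‖ = 1` at a place `w ∤ ℓ`, for every `z ∈ K_wˣ`** (`K` totally complex, `χ`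
algebraic): `ψ_ℓ(⟨z⟩_w) = ι⁻¹(χ(⟨z⟩_w))` there (`coe_lAdicAvatarHom_localUnits_of_not_mem`) and
`ψ_ℓ` is unit-valued. [cite: SerreAbelianLadic1968, Ch. II §2.7, Ch. III §1.1] -/
theorem HasInfinityType.norm_ιsymm_apply_localUnits_eq_one [IsTotallyComplex K]
    (h : χ.HasInfinityType p q) {w : HeightOneSpectrum (𝓞 K)} (hw : ((ℓ : ℕ) : 𝓞 K) ∉ w.asIdeal)
    (z : (w.adicCompletion K)ˣ) : ‖ι.symm ((χ (localUnits w z) : ℂˣ) : ℂ)‖ = 1 := by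
  rw [← coe_lAdicAvatarHom_localUnits_of_not_mem ι (p := p) (q := q) hw z]
  exact h.norm_lAdicAvatarHom_eq_one ι _

/-- The same for the local component `χ_w`. [cite: SerreAbelianLadic1968, Ch. II §2.7] -/
theorem HasInfinityType.norm_ιsymm_localComponent_eq_one [IsTotallyComplex K]
    (h : χ.HasInfinityType p q) {w : HeightOneSpectrum (𝓞 K)} (hw : ((ℓ : ℕ) : 𝓞 K) ∉ w.asIdeal)
    (z : (w.adicCompletion K)ˣ) : ‖ι.symm ((χ.localComponent w z : ℂˣ) : ℂ)‖ = 1 := by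
  rw [localComponent_apply]
  exact h.norm_ιsymm_apply_localUnits_eq_one ι hw z

/-- **The integrality clause of (L)**: at `w ∤ ℓ` every value of `χ_w` is `ℓ`-integral under `ι⁻¹`
(indeed a unit) — the hypothesis `hint` of `HeWei2025.hasLocalMuZero_of_pow_eq_one` /
`hasLocalMuZero_compRelNorm_of_units_pow_eq_one` for an algebraic Hecke character of a CM field.
[cite: SerreAbelianLadic1968, Ch. II §2.7] -/
theorem HasInfinityType.norm_ιsymm_localComponent_le_one [IsTotallyComplex K]
    (h : χ.HasInfinityType p q) {w : HeightOneSpectrum (𝓞 K)} (hw : ((ℓ : ℕ) : 𝓞 K) ∉ w.asIdeal)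
    (z : (w.adicCompletion K)ˣ) : ‖ι.symm ((χ.localComponent w z : ℂˣ) : ℂ)‖ ≤ 1 :=
  (h.norm_ιsymm_localComponent_eq_one ι hw z).le

end HeckeCharacter

end Literature.NumberTheory.GaloisRepresentations

end
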